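import Summits.ValiantsHypothesis.ValiantsHypothesis.Theorems.BarrierLeverChowThinRowsLabelledPairs
import Summits.ValiantsHypothesis.ValiantsHypothesis.Theorems.BarrierLeverChowThinRowsSubcube

/-!
# Route BarrierLever — item `ChowHitsThinRowPartitionMinors` (stmt-ValiantsHypothesis-20195):
# the PAIR LAYER on down-closed column families, IV — a labelled core plus free singleton rows
# (partial layouts)

Helper file (`--supports stmt-ValiantsHypothesis-20195`; cell valiant-natproofs, rung V4, 𝒟-side of
door (c); prover seat val-np-p8 gen 0).  Closes NO item; imports only `…ChowThinRowsLabelledPairs`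
(this seat) and `…ChowThinRowsSubcube` (prover g10); no route file.  Conventions as there.

**Theorem `chowHits_thinRows_of_labelledCore`.**  The design family `𝒟` is down-closed with
`|𝒟| ≤ h + h`; the layout `(u, w)` is injective with thin rows and columns `w j ∈ 𝒟` (a PARTIAL
layout: not all of `𝒟` need occur).  Suppose the rows split into
* a CORE: rows `i` whose columns `w i` form a down-closed subfamily `𝒟₀` (every subset of a core
  column is again a core column), union-labelled as in file I (`⋃_{a ∈ u i} L a = w i`, distinct
  labels inside a row), and
* FREE rows: singletons `{a}` whose variable `a` occurs in no core row (their columns are arbitrary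
  members of `𝒟`).
Then ONE explicit product of `h + h` affine forms hits the layout: core variables `x`-diagonal
(`x_a` in the form `φ_{L a}`), free variables SOLVED so that their row is the unit vector of their own
column (prover g10's device, `leaveOneOut_independent_of_downClosed`), the matrix is block triangular
(`Matrix.twoBlockTriangular_det`) with an identity free block and a core block handled by the
triangular-design criterion (`det_xdiag_ne_zero_of_monotone'`, the version of file I's lemma with a
design family larger than the column family).  Special cases: file I (`𝒟₀ = 𝒟`, no free rows) and
g10's `chowHits_firstOrderRows_of_downClosed` when its `∅`-row (if any) sits at the column `∅`
(core `= {∅}` or empty).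

WHAT THIS IS NOT: Conjecture DC in general is not proved; nothing on items 20195 / 20172 / 19717
themselves, on crux stmt-ValiantsHypothesis-14610, or on `VP` versus `VNP`.
-/

set_option linter.dupNamespace false

namespace Summit.ValiantsHypothesis.ValiantsHypothesis.Theorems.BarrierLever.ChowSubcube

open Finset MvPolynomial
open Summit.ValiantsHypothesis.ValiantsHypothesis.Theorems.BarrierLever.ChowFactor
  (coeff_partitionExpo_mul_affine coeff_partitionExpo_mul_yOnly totalDegree_affine_le)
open Summit.ValiantsHypothesis.ValiantsHypothesis.Theorems.BarrierLever.ProductStateSums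
  (castAdd_ne_natAdd partitionExpo_apply_castAdd partitionExpo_apply_natAdd)
open Summit.ValiantsHypothesis.ValiantsHypothesis.Theorems.BarrierLever.CorankRepair (partitionExpo_eq_iff)

variable {h : ℕ}

/-! ## 1. The `x`-diagonal determinant with a design family larger than the column family -/

/-- `det_xdiag_ne_zero_of_monotone` with the indicator forms taken over a down-closed DESIGN family
`𝒟 ⊇ 𝒟₀`, the columns enumerating (sorted by cardinality) the down-closed COLUMN family `𝒟₀`. -/
theorem det_xdiag_ne_zero_of_monotone' (DD DD₀ : Finset (Finset (Fin h))) (hsub : DD₀ ⊆ DD)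
    (hDD₀ : ∀ W ∈ DD₀, ∀ U : Finset (Fin h), U ⊆ W → U ∈ DD₀)
    (r : ℕ) (u w : Fin r → Finset (Fin h)) (hw : Function.Injective w)
    (hu2 : ∀ i, (u i).card ≤ 2) (hwD : ∀ j, w j ∈ DD₀) (hsurj : ∀ V ∈ DD₀, ∃ j, w j = V)
    (hmono : Monotone fun j => (w j).card)
    (κ : Fin h → Finset (Fin h) → ℂ) (L : Fin h → Finset (Fin h))
    (hκ : ∀ i, ∀ a ∈ u i, ∀ V ∈ DD, κ a V = if V = L a then 1 else 0)
    (hLab : ∀ i, (u i).biUnion L = w i)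
    (hLinj : ∀ i, ∀ a ∈ u i, ∀ b ∈ u i, L a = L b → a = b) :
    (Matrix.of fun i j : Fin r => MvPolynomial.coeff
        (∑ a ∈ u i, Finsupp.single (Fin.castAdd h a) 1 +
          ∑ c ∈ w j, Finsupp.single (Fin.natAdd h c) 1)
        (∏ V ∈ DD, (C 1 + ∑ a, C (κ a V) * X (Fin.castAdd h a) +
          ∑ c, C (if c ∈ V then (1 : ℂ) else 0) * X (Fin.natAdd h c)))).det ≠ 0 := by
  classical
  have hL : ∀ i, ∀ a ∈ u i, L a ∈ DD := fun i a ha =>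
    hsub (hDD₀ (w i) (hwD i) (L a) (by rw [← hLab i]; exact Finset.subset_biUnion_of_mem L ha))
  refine det_ne_zero_of_triangularDesign DD₀ hDD₀ r u w hw hwD hsurj hmono _
    (∏ V' ∈ DD, (C 1 + ∑ a, C ((fun (_ : Fin h) (_ : Finset (Fin h)) => (0 : ℂ)) a V') * X (Fin.castAdd h a) +
      ∑ c, C (if c ∈ V' then (1 : ℂ) else 0) * X (Fin.natAdd h c)))
    (coeff_empty_empty_prod _ _)
    (fun i => ∏ a ∈ u i, ∑ U ∈ (L a).powerset,
      monomial (∑ a' ∈ (∅ : Finset (Fin h)), Finsupp.single (Fin.castAdd h a') 1 +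
        ∑ c ∈ U, Finsupp.single (Fin.natAdd h c) 1) ((-1 : ℂ) ^ U.card * (U.card.factorial : ℂ)))
    (fun i => yOnly_prod (u i) _ fun a _ => yOnly_tinv (L a))
    (fun i j => coeff_xdiag_row DD κ L (u i) (hu2 i) (hL i) (hLinj i) (hκ i) (w j))
    (fun i k hne => ?_) (fun i => ?_)
  · have hsub' : w k ⊆ w i := by
      rw [← hLab i]
      exact coeff_tprod_subset (u i) L (w k) hne
    rcases (Finset.card_le_card hsub').lt_or_eq with hlt | heq
    · exact Or.inl hlt
    · exact Or.inr (hw (Finset.eq_of_subset_of_card_le hsub' heq.ge))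
  · obtain ⟨n, hn, hn1⟩ := coeff_tprod_signed (u i) L (w i)
    rw [hn]
    have h1 : 1 ≤ n := hn1 (hLab i).symm
    exact mul_ne_zero (pow_ne_zero _ (by norm_num)) (by exact_mod_cast (by omega : n ≠ 0))

/-! ## 2. Labelled core plus free singleton rows -/

/-- **PAIR LAYER — LABELLED CORE + FREE SINGLETON ROWS, partial layouts, every height** (item
`ChowHitsThinRowPartitionMinors`, stmt-ValiantsHypothesis-20195, on that slice).  See the module
docstring: core rows (columns forming a down-closed subfamily, union-labelled) are made triangular
by the `x`-diagonal design, free singleton rows (variables outside the core) are solved to the unit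
vectors of their own columns. -/
theorem chowHits_thinRows_of_labelledCore (h : ℕ) (DD : Finset (Finset (Fin h)))
    (hDD : ∀ W ∈ DD, ∀ U : Finset (Fin h), U ⊆ W → U ∈ DD) (hcard : DD.card ≤ h + h)
    (r : ℕ) (u w : Fin r → Finset (Fin h)) (hu : Function.Injective u) (hw : Function.Injective w)
    (hu2 : ∀ i, (u i).card ≤ 2) (hwD : ∀ j, w j ∈ DD)
    (core : Fin r → Prop) [DecidablePred core]
    (hcore : ∀ i, core i → ∀ U : Finset (Fin h), U ⊆ w i → ∃ i', core i' ∧ w i' = U)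
    (L : Fin h → Finset (Fin h)) (hLab : ∀ i, core i → (u i).biUnion L = w i)
    (hLinj : ∀ i, core i → ∀ a ∈ u i, ∀ b ∈ u i, L a = L b → a = b)
    (hfree : ∀ i, ¬ core i → ∃ a, u i = {a} ∧ ∀ i', core i' → a ∉ u i') :
    ∃ ℓ : Fin (h + h) → MvPolynomial (Fin (h + h)) ℂ, (∀ k, (ℓ k).totalDegree ≤ 1) ∧
      (Matrix.of fun i j : Fin r => MvPolynomial.coeff
        (∑ a ∈ u i, Finsupp.single (Fin.castAdd h a) 1 +
          ∑ c ∈ w j, Finsupp.single (Fin.natAdd h c) 1) (∏ k, ℓ k)).det ≠ 0 := by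
  classical
  -- Step 1 (prover g10's device): the leave-one-out matrix over `DD` is invertible
  set PT : Finset (Finset (Fin h)) := DD with hPT
  set ℰ : Matrix PT PT ℂ := Matrix.of fun V W =>
    coeff (∑ a ∈ (∅ : Finset (Fin h)), Finsupp.single (Fin.castAdd h a) 1 +
        ∑ c ∈ (W : Finset (Fin h)), Finsupp.single (Fin.natAdd h c) 1)
      (∏ V' ∈ PT.erase (V : Finset (Fin h)),
        (C 1 + ∑ a, C ((fun (_ : Fin h) (_ : Finset (Fin h)) => (0 : ℂ)) a V') * X (Fin.castAdd h a) +
          ∑ c, C (if c ∈ V' then (1 : ℂ) else 0) * X (Fin.natAdd h c))) with hℰ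
  have hinj : Function.Injective ℰ.vecMul := by
    intro c₁ c₂ hc
    rw [← sub_eq_zero]
    have h0 : Matrix.vecMul (c₁ - c₂) ℰ = 0 := by
      rw [Matrix.sub_vecMul]
      exact sub_eq_zero.mpr hc
    set c := c₁ - c₂ with hcdef
    let cV : Finset (Fin h) → ℂ := fun V => if hV : V ∈ PT then c ⟨V, hV⟩ else 0
    have hcV : ∀ W ∈ PT, ∑ V ∈ PT, cV V *
        coeff (∑ a ∈ (∅ : Finset (Fin h)), Finsupp.single (Fin.castAdd h a) 1 +
            ∑ c ∈ W, Finsupp.single (Fin.natAdd h c) 1)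
          (∏ V' ∈ PT.erase V, (C 1 + ∑ a, C ((fun (_ : Fin h) (_ : Finset (Fin h)) => (0 : ℂ)) a V') *
            X (Fin.castAdd h a) + ∑ c, C (if c ∈ V' then (1 : ℂ) else 0) * X (Fin.natAdd h c))) = 0 := by
      intro W hW
      have e := congr_fun h0 ⟨W, hW⟩
      change ∑ V : PT, c V * ℰ V ⟨W, hW⟩ = 0 at e
      have hsum : ∑ V ∈ PT, cV V *
          coeff (∑ a ∈ (∅ : Finset (Fin h)), Finsupp.single (Fin.castAdd h a) 1 +
              ∑ c ∈ W, Finsupp.single (Fin.natAdd h c) 1)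
            (∏ V' ∈ PT.erase V, (C 1 + ∑ a, C ((fun (_ : Fin h) (_ : Finset (Fin h)) => (0 : ℂ)) a V') *
              X (Fin.castAdd h a) + ∑ c, C (if c ∈ V' then (1 : ℂ) else 0) * X (Fin.natAdd h c))) =
          ∑ V : PT, c V * ℰ V ⟨W, hW⟩ := by
        rw [← Finset.sum_coe_sort PT]
        refine Finset.sum_congr rfl fun V _ => ?_
        simp only [cV, dif_pos V.2, hℰ, Matrix.of_apply]
      rw [hsum]
      exact e
    have hz := leaveOneOut_independent_of_downClosed PT (by rw [hPT]; exact hDD) cV hcV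
    funext V
    have := hz V V.2
    simp only [cV, dif_pos V.2] at this
    simpa using this
  have hsurj : Function.Surjective ℰ.vecMul :=
    Matrix.vecMul_surjective_iff_isUnit.mpr (Matrix.vecMul_injective_iff_isUnit.mp hinj)
  -- Step 2: the free rows' coefficients, solved to the indicator of their own column
  choose cvec hcvec using fun i : Fin r => hsurj (fun W : PT => if (W : Finset (Fin h)) = w i then (1 : ℂ) else 0)
  -- Step 3: the design
  set κ : Fin h → Finset (Fin h) → ℂ := fun a V =>
    if (∃ i, core i ∧ a ∈ u i) then (if V = L a then 1 else 0)
    else if hf : (∃ i, ¬ core i ∧ u i = {a}) then (if hV : V ∈ PT then cvec (Classical.choose hf) ⟨V, hV⟩ else 0)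
    else 0 with hκdef
  have hκcore : ∀ i, core i → ∀ a ∈ u i, ∀ V ∈ DD, κ a V = if V = L a then 1 else 0 := by
    intro i hi a ha V _
    simp only [hκdef, if_pos (⟨i, hi, ha⟩ : ∃ i, core i ∧ a ∈ u i)]
  have hκfree : ∀ i a, ¬ core i → u i = {a} → ∀ V (hV : V ∈ PT), κ a V = cvec i ⟨V, hV⟩ := by
    intro i a hi hia V hV
    obtain ⟨a', ha', hnot⟩ := hfree i hi
    have haa : a = a' := by
      have : a ∈ u i := by rw [hia]; exact Finset.mem_singleton_self a
      rw [ha'] at this; exact Finset.mem_singleton.mp this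
    have hnc : ¬ (∃ i', core i' ∧ a ∈ u i') := fun ⟨i', hi', hai'⟩ => hnot i' hi' (haa ▸ hai')
    have hf : ∃ i', ¬ core i' ∧ u i' = {a} := ⟨i, hi, hia⟩
    have hci : Classical.choose hf = i :=
      hu ((Classical.choose_spec hf).2.trans hia.symm)
    simp only [hκdef, if_neg hnc, dif_pos hf, dif_pos hV, hci]
  -- Step 4: the forms and their embedding into `Fin (h + h)`
  obtain ⟨ℓ, hℓdeg, hℓprod⟩ := exists_forms_of_card_le PT (by rw [hPT]; exact hcard)
    (fun V => C 1 + ∑ a, C (κ a V) * X (Fin.castAdd h a) +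
      ∑ c, C (if c ∈ V then (1 : ℂ) else 0) * X (Fin.natAdd h c))
    (fun V _ => by
      have e : (C 1 + ∑ a, C (κ a V) * X (Fin.castAdd h a) +
          ∑ c, C (if c ∈ V then (1 : ℂ) else 0) * X (Fin.natAdd h c) : MvPolynomial (Fin (h + h)) ℂ) =
          C 1 + ∑ v : Fin (h + h), C (Fin.append (fun a => κ a V)
            (fun c => if c ∈ V then (1 : ℂ) else 0) v) * X v := by
        rw [Fin.sum_univ_add]
        simp only [Fin.append_left, Fin.append_right, add_assoc]
      rw [e]
      exact totalDegree_affine_le _ _)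
  refine ⟨ℓ, hℓdeg, ?_⟩
  rw [hℓprod]
  set M : Matrix (Fin r) (Fin r) ℂ := Matrix.of fun i j : Fin r => MvPolynomial.coeff
    (∑ a ∈ u i, Finsupp.single (Fin.castAdd h a) 1 + ∑ c ∈ w j, Finsupp.single (Fin.natAdd h c) 1)
    (∏ V ∈ PT, (C 1 + ∑ a, C (κ a V) * X (Fin.castAdd h a) +
      ∑ c, C (if c ∈ V then (1 : ℂ) else 0) * X (Fin.natAdd h c))) with hM
  -- Step 5: free rows are the unit rows
  have hfreeRow : ∀ i j, ¬ core i → M i j = if j = i then 1 else 0 := by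
    intro i j hi
    obtain ⟨a, hia, -⟩ := hfree i hi
    rw [hM, Matrix.of_apply, hia, coeff_single_prod, ← Finset.sum_coe_sort PT]
    have hsum : ∑ V : PT, κ a (V : Finset (Fin h)) *
        coeff (∑ a' ∈ (∅ : Finset (Fin h)), Finsupp.single (Fin.castAdd h a') 1 +
            ∑ c ∈ w j, Finsupp.single (Fin.natAdd h c) 1)
          (∏ V' ∈ PT.erase (V : Finset (Fin h)), (C 1 + ∑ a, C (κ a V') * X (Fin.castAdd h a) +
            ∑ c, C (if c ∈ V' then (1 : ℂ) else 0) * X (Fin.natAdd h c))) =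
        ∑ V : PT, cvec i V * ℰ V ⟨w j, hwD j⟩ := by
      refine Finset.sum_congr rfl fun V _ => ?_
      rw [hκfree i a hi hia V V.2, coeff_empty_prod_eq κ (fun _ _ => (0 : ℂ)) (PT.erase V) (w j)]
      simp only [hℰ, Matrix.of_apply]
    have e := congr_fun (hcvec i) ⟨w j, hwD j⟩
    change ∑ V : PT, cvec i V * ℰ V ⟨w j, hwD j⟩ = (if w j = w i then (1 : ℂ) else 0) at e
    rw [hsum, e]
    by_cases hij : j = i
    · subst hij; simp
    · rw [if_neg (fun e' => hij (hw e')), if_neg hij]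
  -- Step 6: block structure
  rw [Matrix.twoBlockTriangular_det M core (fun i hi j hj => by
    rw [hfreeRow i j hi, if_neg]; rintro rfl; exact hi hj)]
  have hfreeBlock : Matrix.toSquareBlockProp M (fun i => ¬ core i) = 1 := by
    ext i j
    rw [Matrix.toSquareBlockProp_def, Matrix.of_apply, hfreeRow i j i.2, Matrix.one_apply]
    by_cases hij : i = j
    · subst hij; simp
    · rw [if_neg (fun e => hij (Subtype.ext e.symm)), if_neg hij]
  rw [hfreeBlock, Matrix.det_one, mul_one]
  -- Step 7: the core block, sorted by cardinality
  set n₀ := Fintype.card {i // core i} with hn₀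
  set e₀ : Fin n₀ ≃ {i // core i} := (Fintype.equivFin {i // core i}).symm with he₀
  set σ : Equiv.Perm (Fin n₀) := Tuple.sort fun k => (w (e₀ k)).card with hσ
  have hmono : Monotone fun k => (w (e₀ (σ k))).card := Tuple.monotone_sort fun k => (w (e₀ k)).card
  set DD₀ : Finset (Finset (Fin h)) := (Finset.univ.filter core).image w with hDD₀
  have hDD₀down : ∀ W ∈ DD₀, ∀ U : Finset (Fin h), U ⊆ W → U ∈ DD₀ := by
    intro W hW U hU
    obtain ⟨i, hi, rfl⟩ := Finset.mem_image.mp hW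
    obtain ⟨i', hi', hi'U⟩ := hcore i (Finset.mem_filter.mp hi).2 U hU
    exact Finset.mem_image.mpr ⟨i', Finset.mem_filter.mpr ⟨Finset.mem_univ _, hi'⟩, hi'U⟩
  have hdet := det_xdiag_ne_zero_of_monotone' PT DD₀
    (fun W hW => by obtain ⟨i, -, rfl⟩ := Finset.mem_image.mp hW; exact hwD i) hDD₀down n₀
    (fun k => u (e₀ (σ k))) (fun k => w (e₀ (σ k)))
    (fun k k' e => σ.injective (e₀.injective (Subtype.ext (hw e))))
    (fun k => hu2 _)
    (fun k => Finset.mem_image.mpr ⟨_, Finset.mem_filter.mpr ⟨Finset.mem_univ _, (e₀ (σ k)).2⟩, rfl⟩)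
    (fun V hV => by
      obtain ⟨i, hi, rfl⟩ := Finset.mem_image.mp hV
      refine ⟨σ.symm (e₀.symm ⟨i, (Finset.mem_filter.mp hi).2⟩), ?_⟩
      simp)
    hmono κ L (fun k a ha V hV => hκcore _ (e₀ (σ k)).2 a ha V hV)
    (fun k => hLab _ (e₀ (σ k)).2) (fun k => hLinj _ (e₀ (σ k)).2)
  intro hzero
  apply hdet
  rw [← Matrix.det_submatrix_equiv_self (e₀.symm.trans σ.symm).symm] at hzero
  refine Eq.trans ?_ hzero
  congr 1

end Summit.ValiantsHypothesis.ValiantsHypothesis.Theorems.BarrierLever.ChowSubcube
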